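import Summits.PneNP.PneNP.Theses.KrwChromaticSteering
import Summits.PneNP.PneNP.Theorems.KrwChromaticSteeringCompositionIterationIterate
import HarnessLib

/-!
# Crux `StrongComposition` (stmt-PneNP-18538): the `∀`-antisymmetric-`g` strengthening is false

Negative lemma of the refuter seat (pnp-krw-ref-1, successor g1, 2026-08-27), sharpening
`StrongComposition.Negative.not_strongComposition_forall_g`: even restricted to ANTISYMMETRIC
(self-dual) non-constant inner functions `g` — the class singled out by the crux-ideate card
`Cruxes/StrongComposition/Ideas/antisymmetric-direct-sum.md`, where antisymmetry makes Meir's strong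
game embed into the two-fold direct sum `KW_f × KW_g` — the `∀ g` form of C1 is false, because the
dictator `u ↦ u j` is antisymmetric and makes the strong game trivial.  So in that card's
`DirectSumLB` (as in C1) the `∃ g` must select a depth-hard `g`; antisymmetry carries no weight by
itself.
-/

set_option linter.dupNamespace false
set_option autoImplicit false

open Literature.Computability.Complexity
open Summit.PneNP.PneNP.Theorems.KrwCompositionIteration (exists_mul_succ_lt_two_pow)

namespace Summit.PneNP.PneNP.Theorems.StrongComposition.Negative

/-- **The `∀`-antisymmetric-`g` form of `StrongComposition` is FALSE.**  Refuted statement: for some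
`c`, for all `m n ≥ 1`, every non-constant `f`, EVERY non-constant `g` with `g (¬u) = ¬ g u` for all
`u`, and every protocol `P` solving the strong game `KW_f ⊛ KW_g`, some `KW_f` protocol `Q` has
`depth Q + n ≤ depth P + c (⌊log₂ (m n)⌋ + 1)`.  Witness: `m = 1`, `f a = a 0`, `g u = u 0` (an
antisymmetric dictator), `n = 2^t` with `c (t+1) < 2^t`, `P = leaf (0, 0)` of depth `0` (entry
`(0,0)` differs and so do the row labels whenever `f ⋄ g` separates `X` from `Y`); the conclusion
would force `2^t ≤ c (t+1)`. [folklore] -/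
theorem not_strongComposition_forall_antisymm_g :
    ¬ ∃ c : ℕ, ∀ m n : ℕ, 1 ≤ n → ∀ f : (Fin m → Bool) → Bool, (∃ a b, f a ≠ f b) →
      ∀ g : (Fin n → Bool) → Bool, (∀ u : Fin n → Bool, g (fun j => !u j) = !g u) →
        (∃ u v, g u ≠ g v) →
        ∀ P : KWTree (Fin m × Fin n), P.SolvesStrong f g →
          ∃ Q : KWTree (Fin m), Q.Solves f ∧ Q.depth + n ≤ P.depth + c * (Nat.log 2 (m * n) + 1) := by
  rintro ⟨c, h⟩
  obtain ⟨t, ht⟩ := exists_mul_succ_lt_two_pow c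
  have hn : 1 ≤ 2 ^ t := Nat.one_le_two_pow
  let j0 : Fin (2 ^ t) := ⟨0, hn⟩
  obtain ⟨Q, -, hQ⟩ := h 1 (2 ^ t) hn (fun a => a 0) ⟨fun _ => true, fun _ => false, by simp⟩
    (fun u => u j0) (fun _ => rfl) ⟨fun _ => true, fun _ => false, by simp⟩
    (KWTree.leaf ((0 : Fin 1), j0))
    (by
      intro X Y hX hY
      simp only [blockComp_apply, rowLabels_apply, row_apply] at hX hY
      simp only [KWTree.run_leaf, rowLabels_apply, row_apply, hX, hY, ne_eq, Bool.true_eq_false,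
        not_false_eq_true, and_self])
  rw [KWTree.depth_leaf, one_mul, Nat.log_pow one_lt_two] at hQ
  omega

end Summit.PneNP.PneNP.Theorems.StrongComposition.Negative
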